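import Literature.Probability.RandomPlanarGeometry.FrontierTiltedSAWLaw
import Literature.Probability.RandomPlanarGeometry.SAWBridgeRadius
import HarnessLib

/-!
# The critical curve of the frontier-tilted SAW family at `s = 0`: `x(0) = x_c`

Topic `Literature/Probability/RandomPlanarGeometry`; the leaf announced in
`FrontierTiltedSAWLaw.lean` (notion `FrontierTiltedSAWLaw`, route SAWFrontierHomotopy): it joins
the cone-clean definition file (`SAW.criticalTilt`, `criticalTilt_zero_eq`: at `s = 0` the critical
curve is the radius of finiteness of the bridge generating function `∑ₙ bₙ xⁿ`, whatever the
half-plane frontier weight) with `SAWBridgeRadius.lean` (`sSup_bridgeSeries_ne_top`: that radius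
is `x_c = 1/μ`, from the Hammersley–Welsh bounds `e^{-c√n} μⁿ ≤ bₙ ≤ μⁿ`, Madras–Slade
Corollary 3.1.6), whose import cone (`BDGS2012.lean`) is deliberately kept out of the definition
file.

## Contents (PROVED)

* `criticalTilt_zero` — **`x(0) = x_c`**: `SAW.criticalTilt Bh 0 = SAW.criticalFugacity` for
  every half-plane weight `Bh` — the `s = 0` sanity value of the definition request (at `s = 0`
  the tilted family is the critical SAW, `SAW.tiltedLaw_zero_criticalFugacity`).
-/

noncomputable section

open Literature.Probability.LatticeModels Literature.Probability.Percolation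
open scoped ENNReal

namespace Literature.Probability.RandomPlanarGeometry.SAW

/-- **`x(0) = x_c`**: at `s = 0` the critical curve of the frontier-tilted family is the critical
fugacity of the self-avoiding walk, for every half-plane frontier weight (`B^0 = 1`, so the
series is the bridge generating function, whose radius of finiteness is `1/μ_Bridge = 1/μ`).
[cite: MadrasSlade1993, Corollary 3.1.6] -/
theorem criticalTilt_zero (Bh : ∀ v : Site 2, (zdGraph 2).Walk (0 : Site 2) v → ℝ≥0∞) :
    criticalTilt Bh 0 = criticalFugacity := by
  rw [criticalTilt_zero_eq, sSup_bridgeSeries_ne_top]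

end Literature.Probability.RandomPlanarGeometry.SAW
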